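import Summits.RiemannHypothesis.RiemannHypothesis.Theorems.TiltedLandingLaw421R3RateSkeletonWalkLaws

/-! # GLUE-2A on the MULTIPLICITY-FREE (moving-child) typing — landing cut (3m), v4b
v4b = `rh33346-cover/lens2/Glue2A-v4a.lean` 224f9e4d l.36–410 VERBATIM, re-pointed to the primed twins of `…R3RateSkeletonB` / `…WalkLaws` (only textual
change: `F1OfModulusLawA ↦ F1OfModulusLawA'` ×6 and the five law names in `farEnergyLawCQ_of_childLaws` primed) + this shorter header (history: v4a's).
§G.1 the residual laws: (R1a′) `FarChildExistsLawSep` — at a charged far level whose lowest isolated pair `v` (ANY multiplicity) has no strictly taller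
disc-toucher (crit-1's separation binder C′; the un-separated R1a was KILLED as typed by CE1, child ratio 1.000105), `v` has a MOVING upper child `w` in its
closed axis-centred Jensen disc (`f⁽ʲ⁺¹⁾ w = 0`, `f⁽ʲ⁾ w ≠ 0`, `0 < Im w`, `‖w − Re v‖ ≤ Im v`); (R1t) `ToucherLaw`, derived in §G.5 from the dimensionless
`TouchChildLaw θ c'` (`4/5(1+θ)² ≤ c'`; record `(1/200, 81/100)`) and its existential form `TouchChildLawEx`; (R1b) `HalfAloftLaw` (`s/2 ≤ Im v`).  §G.2 the
books' `lowH`, the quarter-high child.  §G.3 GLUE-2A PROVED, `f1OfModulusLawA_of_childLaws : FarChildExistsLawSep → ToucherLaw → HalfAloftLaw →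
F1OfModulusLawA'`: `by_cases` on C′ — separated ⇒ R1a′'s moving child, pair factorisation by two `dslope`s (any multiplicity), `crit_field_identity_iteratedDeriv`,
quarter-high + half-aloft ⇒ high zone, sharp step `RhW08.FarStep.sharp_step_energy_eta_weak` with `κ = λη/s` from the PRIMED modulus law `FarFieldModulusLawA'`,
whose binder `f⁽ʲ⁾ w ≠ 0` is exactly what R1a′ delivers (the reason for the fork); touched ⇒ the toucher law — and `farEnergyLawCQ_of_childLaws` (∘
`farEnergyLawCQ_of_lawsB`).  §G.4 the exact sign-free `drop_identity` (on CE1 F1 affords `8.9e-5` against the actual `2.1e-4`: touchers are a population).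
Residual laws TYPED, not proved.  Sorry-free; axioms standard.  Nothing here bears on the truth of RH; RH is not proved; 33346/33347 OPEN; checked ≠ proved. -/
namespace RhW08.BurgersRateG3
open Complex Metric
open scoped ComplexConjugate
open RhW08.Round1 RhW08.StSwap RhW08.Round2 RhW08.QuadW
open RhW08.SealSwap (PBot)
open RhW08.SealSwapQ RhW08.RateSplit RhW08.IsolatedTilt RhW08.FarStep RhW08.BurgersRate RhW08.PurseP
open RhIdea6.G17.W07C7 RhIdea6.G17.W07C7.Rev6 RhIdea6.G18.W07C8.Law421BirthS RhIdea6.G19.W07C11.Seam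
open RhIdea6.G20.W07C12.Frac RhIdea6.G20.W07C12.StColP RhW07.C12.FieldSplit RhIdea6.G21.W07C13.TentMax
open RhW07.C14.TwoSided RhW07.C14.Classes RhW07.C14.Lineage RhW07.C14.Booking

/-! ## §G.1 the two residual laws of GLUE-2A (multiplicity-free) -/

/-- (LAW R1a′ — SEPARATED FAR-LEVEL CHILD EXISTENCE; typed, OPEN; the CE1 re-type of R1a) at a charged far level whose lowest isolated pair `v`
(any multiplicity) has NO STRICTLY TALLER DISC-TOUCHER (crit-1's C′ = `RhW08.Lens1Pinning.NoTallerToucher f j v`, written out: every zero `z` of `f⁽ʲ⁾`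
with `Im v < Im z` has `Im v + Im z < |Re v − Re z|`), `v` has a MOVING upper child in its closed axis-centred Jensen disc: a zero `w` of `f⁽ʲ⁺¹⁾` with
`f⁽ʲ⁾(w) ≠ 0`, `0 < Im w`, `‖w − Re v‖ ≤ Im v` (sharp: the model child sits ON the circle).  Rouché/Jensen in the disc; column T-DISC restricted to
separated levels (lens-2 corpora, all lone-pair hence separated: max 0.99870 / 0.99976 / 0.999913, 0 rows > 1); CE1 is NOT in its population. -/
def FarChildExistsLawSep : Prop :=
  ∀ (η : ℝ) (f : ℂ → ℂ) (x₀ s hmax R Hs : ℝ) (B : ℕ), EngineHyps5 2 η f x₀ s hmax R Hs B →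
    ∀ (j : ℕ) (v : ℂ), Charged (PTrkSQ PBot) StTrkDQ ReadyR2 η f x₀ s hmax R Hs B j →
      IsLowest StTrkDQ η f x₀ s hmax R Hs B j v →
      (∀ z : ℂ, iteratedDeriv j f z = 0 → |z.re - v.re| < R / 2 → z = v ∨ z = conj v) →
      (∀ z : ℂ, iteratedDeriv j f z = 0 → v.im < z.im → v.im + z.im < |v.re - z.re|) →
      ∃ w : ℂ, iteratedDeriv (j + 1) f w = 0 ∧ iteratedDeriv j f w ≠ 0 ∧ 0 < w.im ∧ ‖w - (v.re : ℂ)‖ ≤ |v.im|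

/-- (LAW R1t — TOUCHER LAW; typed, OPEN; director (CA527)(2)) what F1 needs on the TOUCHER population: at a charged far level whose lowest isolated pair
`v` IS disc-touched by a strictly taller zero `z` of `f⁽ʲ⁾` (`Im v < Im z`, `|Re v − Re z| ≤ Im v + Im z`; by isolation `z` lies beyond the lateral
`R/2`-window, so `Im v + Im z ≥ R/2`: a TALL far zero near the window edge), F1's summand `(4/5)·s² ≤ η²·(lowH j² − lowH (j+1)²)` holds.  The moving child
then sits slightly OUTSIDE `v`'s disc (CE1: by `1.05e-4`, exactly `u = 2S·Im K̃(w)/(κ²b²·Im w)`), where the sharp step's `hsign` fails but the drop does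
not (CE1: margin ×1.533; field `0.90·η/s`).  `Charged` binder kept (CA522).  Columns: T-CE1 (PASS) and T-TOUCH := F1's margin over touched charged far
levels of multi-pair corpora (lens-2's lone-pair corpora contain none). -/
def ToucherLaw : Prop :=
  ∀ (η : ℝ) (f : ℂ → ℂ) (x₀ s hmax R Hs : ℝ) (B : ℕ), EngineHyps5 2 η f x₀ s hmax R Hs B →
    ∀ (j : ℕ) (v : ℂ), Charged (PTrkSQ PBot) StTrkDQ ReadyR2 η f x₀ s hmax R Hs B j →
      IsLowest StTrkDQ η f x₀ s hmax R Hs B j v →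
      (∀ z : ℂ, iteratedDeriv j f z = 0 → |z.re - v.re| < R / 2 → z = v ∨ z = conj v) →
      (∃ z : ℂ, iteratedDeriv j f z = 0 ∧ v.im < z.im ∧ |v.re - z.re| ≤ v.im + z.im) →
      4 / 5 * s ^ 2 ≤ η ^ 2 * (lowH StTrkDQ η f x₀ s hmax R Hs B j ^ 2 - lowH StTrkDQ η f x₀ s hmax R Hs B (j + 1) ^ 2)

/-- (LAW R1b — HALF-ALOFT; typed, OPEN) at a charged far level the lowest isolated pair is at least half a step aloft: `s/2 ≤ Im v`.  A sub-half-step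
isolated pair in a legal field is a dip (tilt-ready, hence uncharged); physically `b ≳ 2/(κ²s)` at charged far levels.  Column T-ALOFT (kill `< 1/2`). -/
def HalfAloftLaw : Prop :=
  ∀ (η : ℝ) (f : ℂ → ℂ) (x₀ s hmax R Hs : ℝ) (B : ℕ), EngineHyps5 2 η f x₀ s hmax R Hs B →
    ∀ (j : ℕ) (v : ℂ), Charged (PTrkSQ PBot) StTrkDQ ReadyR2 η f x₀ s hmax R Hs B j →
      IsLowest StTrkDQ η f x₀ s hmax R Hs B j v →
      (∀ z : ℂ, iteratedDeriv j f z = 0 → |z.re - v.re| < R / 2 → z = v ∨ z = conj v) →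
      s / 2 ≤ v.im

/-- (K) **pair factorisation without simplicity**: a function holomorphic on a ball and vanishing at `a ± ib` (`b ≠ 0`) is `pairQ a b · h` there with
`h` holomorphic (two `dslope`s; the construction half of `RhW08.IsolatedTilt.exists_pair_factor`, no zero-freeness claimed or needed). -/
theorem exists_pair_factor_weak {G : ℂ → ℂ} {a b ρ : ℝ} (hb : b ≠ 0) (hbρ : |b| < ρ)
    (hG : DifferentiableOn ℂ G (ball (a : ℂ) ρ)) (hG1 : G (a + b * I) = 0) (hG2 : G (a - b * I) = 0) :
    ∃ h : ℂ → ℂ, DifferentiableOn ℂ h (ball (a : ℂ) ρ) ∧ ∀ z ∈ ball (a : ℂ) ρ, G z = pairQ a b z * h z := by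
  set z₁ : ℂ := a + b * I with hz₁
  set z₂ : ℂ := a - b * I with hz₂
  have h12 : z₁ ≠ z₂ := by
    intro h
    have := congrArg Complex.im h
    simp [hz₁, hz₂] at this
    exact hb (by linarith)
  have hmem1 : z₁ ∈ ball (a : ℂ) ρ := by
    rw [mem_ball, dist_eq_norm, hz₁, show (a : ℂ) + b * I - a = b * I by ring, norm_mul, Complex.norm_I, mul_one,
      Complex.norm_real, Real.norm_eq_abs]
    exact hbρ
  have hmem2 : z₂ ∈ ball (a : ℂ) ρ := by
    rw [mem_ball, dist_eq_norm, hz₂, show (a : ℂ) - b * I - a = -(b * I) by ring, norm_neg, norm_mul, Complex.norm_I, mul_one,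
      Complex.norm_real, Real.norm_eq_abs]
    exact hbρ
  set D : ℂ → ℂ := dslope G z₁ with hD
  set h : ℂ → ℂ := dslope D z₂ with hh
  have hDdiff : DifferentiableOn ℂ D (ball (a : ℂ) ρ) :=
    (Complex.differentiableOn_dslope (isOpen_ball.mem_nhds hmem1)).2 hG
  have hhdiff : DifferentiableOn ℂ h (ball (a : ℂ) ρ) :=
    (Complex.differentiableOn_dslope (isOpen_ball.mem_nhds hmem2)).2 hDdiff
  have hGD : ∀ z, G z = (z - z₁) * D z := by
    intro z
    have := sub_smul_dslope_of_zero (f := G) (a := z₁) hG1 z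
    rw [smul_eq_mul] at this
    exact this.symm
  have hD2 : D z₂ = 0 := by
    have := hGD z₂
    rw [hG2] at this
    rcases mul_eq_zero.mp this.symm with h0 | h0
    · exact absurd (sub_eq_zero.mp h0) h12.symm
    · exact h0
  have hDh : ∀ z, D z = (z - z₂) * h z := by
    intro z
    have := sub_smul_dslope_of_zero (f := D) (a := z₂) hD2 z
    rw [smul_eq_mul] at this
    exact this.symm
  refine ⟨h, hhdiff, fun z _ => ?_⟩
  rw [pairQ_eq_mul, hGD z, hDh z]
  ring

/-! ## §G.2 the books' `lowH` at a far level and the quarter-high child -/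

/-- (K) the lowest height of a level that has a lowest band state `v` is `Im v`. -/
theorem lowH_eq_of_isLowest {η : ℝ} {f : ℂ → ℂ} {x₀ s hmax R Hs : ℝ} {B j : ℕ} {v : ℂ}
    (hlow : IsLowest StTrkDQ η f x₀ s hmax R Hs B j v) : lowH StTrkDQ η f x₀ s hmax R Hs B j = v.im := by
  have hv0 : 0 < v.im := hlow.1.2.2.1
  apply le_antisymm
  · have h := lowH_le hlow.1
    rwa [abs_of_pos hv0] at h
  · refine le_csInf ⟨|v.im|, ⟨v, hlow.1, rfl⟩⟩ ?_
    rintro r ⟨u, hu, rfl⟩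
    have hu0 : 0 < u.im := hu.2.2.1
    show v.im ≤ |u.im|
    rw [abs_of_pos hu0]
    exact hlow.2 u hu

/-- (K) the lowest height is never negative. -/
theorem lowH_nonneg' {η : ℝ} {f : ℂ → ℂ} {x₀ s hmax R Hs : ℝ} {B j : ℕ} : 0 ≤ lowH StTrkDQ η f x₀ s hmax R Hs B j := by
  apply Real.sInf_nonneg
  rintro r ⟨u, -, rfl⟩
  exact abs_nonneg _

/-- (K) at a CHARGED level every band state of the next level is quarter-high: `Im v − s/4 < Im u` (`¬ SuccOf (1/4)` at the charged lowest state,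
whose height is the height of every lowest state). -/
theorem quarter_high_of_charged {η : ℝ} {f : ℂ → ℂ} {x₀ s hmax R Hs : ℝ} {B j : ℕ} {v u : ℂ}
    (hch : Charged (PTrkSQ PBot) StTrkDQ ReadyR2 η f x₀ s hmax R Hs B j) (hlow : IsLowest StTrkDQ η f x₀ s hmax R Hs B j v)
    (hu : StTrkDQ η f x₀ s hmax R Hs B (j + 1) u) : v.im - s / 4 < u.im := by
  obtain ⟨v', hlow', -, hnp⟩ := hch
  have heq : v'.im = v.im := le_antisymm (hlow'.2 v hlow.1) (hlow.2 v' hlow'.1)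
  have hv0 : 0 < v.im := hlow.1.2.2.1
  have hu0 : 0 < u.im := hu.2.2.1
  by_contra hle
  rw [not_lt] at hle
  exact hnp (Or.inr ⟨u, hu, by rw [abs_of_pos hu0, heq, abs_of_pos hv0]; linarith⟩)

/-! ## §G.3 GLUE-2A from (R1a) + (R1b) -/

set_option maxHeartbeats 800000 in
/-- ★★★ (K) **GLUE-2A PROVED (multiplicity-free, CE1-retyped)**: `FarChildExistsLawSep → ToucherLaw → HalfAloftLaw → F1OfModulusLawA'`.  A `by_cases`
on the separation clause C′: touched ⇒ `ToucherLaw` is F1's summand; separated ⇒ the tree's sharp far step at the moving child (v2's proof verbatim);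
no case split on the multiplicity of the lowest zero, no isolation used beyond the laws' own binders. -/
theorem f1OfModulusLawA_of_childLaws (hX : FarChildExistsLawSep) (hT : ToucherLaw) (hA : HalfAloftLaw) : F1OfModulusLawA' := by
  intro lam hlam0 hlam2 hMod η f x₀ s hmax R Hs B hE j hch hfar
  obtain ⟨v, hlow, hiso⟩ := hfar
  obtain ⟨hdiff, hreal, -, hs, -, -, -, -, -, -, -, -, -, hη0, hη1, -⟩ := id hE
  by_cases hsep : ∀ z : ℂ, iteratedDeriv j f z = 0 → v.im < z.im → v.im + z.im < |v.re - z.re|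
  swap
  · -- the TOUCHED branch: a strictly taller disc-toucher exists; `ToucherLaw` is exactly F1's summand there
    push Not at hsep
    obtain ⟨z, hz0, hzt, hzd⟩ := hsep
    exact hT η f x₀ s hmax R Hs B hE j v hch hlow hiso ⟨z, hz0, hzt, hzd⟩
  obtain ⟨w, hw0, hGw, hwim, hbind⟩ := hX η f x₀ s hmax R Hs B hE j v hch hlow hiso hsep
  have hal : s / 2 ≤ v.im := hA η f x₀ s hmax R Hs B hE j v hch hlow hiso
  have hK := hMod η f x₀ s hmax R Hs B hE j v w ⟨v, hlow, hiso⟩ hch hlow hGw hiso hw0 hwim hbind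
  -- coordinates of the pair
  set a : ℝ := v.re with ha
  set b : ℝ := v.im with hb
  have hb0 : 0 < b := hlow.1.2.2.1
  have hv : v = (a : ℂ) + (b : ℂ) * I := by rw [ha, hb]; exact (re_add_im v).symm
  have hcv : conj v = (a : ℂ) - (b : ℂ) * I := Complex.ext (by simp [ha]) (by simp [hb])
  have hbind' : ‖w - (a : ℂ)‖ ≤ b := by rwa [abs_of_pos hb0] at hbind
  -- the child is a band state of level j+1, hence quarter-high; lowH bookkeeping
  have hwS : StTrkDQ η f x₀ s hmax R Hs B (j + 1) w :=
    RhW08.SuccB.stTrkDQ_succ_of_nested hE hlow.1 hw0 hwim (nestedStep_of_binder hbind)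
  have hq : v.im - s / 4 < w.im := quarter_high_of_charged hch hlow hwS
  have hLj : lowH StTrkDQ η f x₀ s hmax R Hs B j = b := lowH_eq_of_isLowest hlow
  have hL1 : lowH StTrkDQ η f x₀ s hmax R Hs B (j + 1) ≤ w.im := by
    have h := lowH_le hwS
    rwa [abs_of_pos hwim] at h
  have hL0 : 0 ≤ lowH StTrkDQ η f x₀ s hmax R Hs B (j + 1) := lowH_nonneg'
  -- the local factorisation f⁽ʲ⁾ = pairQ a b · h on ball a (b+1) (f⁽ʲ⁾ entire; Schwarz reflection gives the conjugate zero)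
  have hGd : Differentiable ℂ (iteratedDeriv j f) := Literature.Analysis.Complex.differentiable_iteratedDeriv_of_entire hdiff j
  have hfconj : ∀ z : ℂ, f (conj z) = conj (f z) := Literature.Analysis.Complex.apply_conj_eq_conj hdiff hreal
  have hGreal : ∀ z : ℂ, iteratedDeriv j f (conj z) = conj (iteratedDeriv j f z) :=
    Literature.NumberTheory.LFunctions.iteratedDeriv_conj_of_conj hfconj j
  have hbρ : |b| < b + 1 := by rw [abs_of_pos hb0]; linarith
  have hG1 : iteratedDeriv j f ((a : ℂ) + (b : ℂ) * I) = 0 := by rw [← hv]; exact hlow.1.2.1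
  have hG2 : iteratedDeriv j f ((a : ℂ) - (b : ℂ) * I) = 0 := by rw [← hcv, hGreal, hlow.1.2.1, map_zero]
  obtain ⟨h, hhd, hGq⟩ := exists_pair_factor_weak hb0.ne' hbρ hGd.differentiableOn hG1 hG2
  have hw : w ∈ ball (a : ℂ) (b + 1) := by
    rw [Metric.mem_ball, dist_eq_norm]; linarith
  have hhw : h w ≠ 0 := by
    intro h0
    exact hGw (by rw [hGq w hw, h0, mul_zero])
  -- the lens observable IS the cofactor field at the moving child
  have hid := crit_field_identity_iteratedDeriv hhd hGq hw hhw hw0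
  have hwv : w - v ≠ 0 := by
    intro h0
    rw [sub_eq_zero.1 h0] at hGw
    exact hGw hlow.1.2.1
  have hwcv : w - conj v ≠ 0 := by
    intro h0
    have h1 : w = conj v := sub_eq_zero.1 h0
    have : w.im = -v.im := by rw [h1]; simp
    linarith
  have hqne : pairQ a b w ≠ 0 := by
    rw [pairQ_eq_mul, ← hv, ← hcv]; exact mul_ne_zero hwv hwcv
  have hKq : deriv h w / h w = -(2 * (w - (a : ℂ))) / pairQ a b w := by
    rw [eq_div_iff hqne, mul_comm]; exact hid
  have hff : farFieldAt f j v w = deriv h w / h w := by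
    rw [hKq]
    unfold farFieldAt levelField
    rw [hw0, zero_div, pairQ_eq_mul, ← hv, ← hcv]
    field_simp
    rw [hcv, hv]
    ring
  have hKM : ‖deriv h w / h w‖ ≤ lam * η / s := by rw [← hff]; exact hK
  -- the degenerate frame η = 0: the modulus law forces K(w) = 0, i.e. w = a on the axis
  rcases hη0.lt_or_eq with hηpos | hηzero
  swap
  · exfalso
    have hK0 : deriv h w / h w = 0 := by
      have : ‖deriv h w / h w‖ ≤ 0 := by simpa [← hηzero] using hKM
      exact norm_le_zero_iff.1 this
    have hwa : w - (a : ℂ) = 0 := by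
      have h2 : -(2 * (w - (a : ℂ))) = 0 := by rw [← hid, hK0, mul_zero]
      have h3 : (2 : ℂ) * (w - (a : ℂ)) = 0 := neg_eq_zero.1 h2
      exact (mul_eq_zero.1 h3).resolve_left two_ne_zero
    have : w.im = 0 := by
      have := congrArg Complex.im hwa
      simpa using this
    linarith
  -- the sharp far step at the moving child
  have hκ : 0 < lam * η / s := div_pos (mul_pos hlam0 hηpos) hs
  have hκη : (lam * η / s) ^ 2 ≤ 5 / 4 * (η / s) ^ 2 := by
    rw [show lam * η / s = lam * (η / s) by ring, mul_pow]
    exact mul_le_mul_of_nonneg_right hlam2 (sq_nonneg _)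
  have hhigh : b ^ 2 ≤ (w.re - a) ^ 2 + 5 * w.im ^ 2 :=
    highZone_of_half_height hb0.le (by rw [hb]; linarith)
  have hstep := sharp_step_energy_eta_weak hhd hGq hw hhw (by rw [← iteratedDeriv_succ]; exact hw0) hwim hs hκ hbind' hhigh hKM hκη
  -- bookkeeping: b = lowH j, lowH (j+1) ≤ Im w
  rw [hLj]
  have hsq : lowH StTrkDQ η f x₀ s hmax R Hs B (j + 1) ^ 2 ≤ w.im ^ 2 := pow_le_pow_left₀ hL0 hL1 2
  nlinarith [hstep, mul_le_mul_of_nonneg_left hsq (sq_nonneg η)]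

/-- (K) corollary in the record currency: the whole F1 socket from EIGHT typed laws — child existence, half-aloft, the five one-level laws and the
low-pair landing law — both glues PROVED. -/
theorem farEnergyLawCQ_of_childLaws (hX : FarChildExistsLawSep) (hT : ToucherLaw) (hA : HalfAloftLaw)
    (hL : LandingExitLawAbove' (5 / 4) 2) (hW : LowLandingLaw (5 / 4) 2)
    (hC : ThresholdCapLawCharged' (1 / 200)) (hB : ThresholdCapLawBelow' (1 / 200)) (hU : UnchargedCreepLaw' (3 / 100))
    (hE : FarChainEntryExitLaw' (1 / 25)) : FarEnergyLawCQ (4 / 5) :=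
  farEnergyLawCQ_of_lawsB (f1OfModulusLawA_of_childLaws hX hT hA) hL hW hC hB hU hE

/-! ## §G.4 the EXACT SIGN-FREE DROP IDENTITY (why touchers are a population, not a rounding error) -/

/-- (K) **EXACT DROP IDENTITY** at a point `w` with `q(w)·K = −2(w − a)` (the crit identity; `K` = the cofactor field) and `K ≠ 0`:
`b² − Im w² = ‖w − a‖²/(b²‖K‖²) + (b² − ‖w − a‖²)(3b² + ‖w − a‖²)/(4b²)` — no nestedness, no high zone.  Outside the disc (`S > b²`) the second
term is the NEGATIVE excess price `−u·b²(1 + u/4)`, `u = S/b² − 1`; inside it is a gain. -/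
theorem drop_identity {w K : ℂ} {a b : ℝ} (hb : b ≠ 0) (hK : K ≠ 0) (hcrit : pairQ a b w * K = -(2 * (w - a))) :
    b ^ 2 - w.im ^ 2 = ‖w - (a : ℂ)‖ ^ 2 / (b ^ 2 * ‖K‖ ^ 2)
      + (b ^ 2 - ‖w - (a : ℂ)‖ ^ 2) * (3 * b ^ 2 + ‖w - (a : ℂ)‖ ^ 2) / (4 * b ^ 2) := by
  set S : ℝ := ‖w - (a : ℂ)‖ ^ 2 with hS_def
  have hS_eq : S = (w.re - a) ^ 2 + w.im ^ 2 := by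
    rw [hS_def, ← Complex.normSq_eq_norm_sq, Complex.normSq_apply, Complex.sub_re, Complex.sub_im, Complex.ofReal_re,
      Complex.ofReal_im, sub_zero]
    ring
  have hP : ‖pairQ a b w‖ ^ 2 = (S + b ^ 2) ^ 2 - 4 * b ^ 2 * w.im ^ 2 := by
    rw [← Complex.normSq_eq_norm_sq, normSq_pairQ, Complex.normSq_eq_norm_sq]
  have hM : ‖pairQ a b w‖ ^ 2 * ‖K‖ ^ 2 = 4 * S := by
    have h : ‖pairQ a b w * K‖ = ‖-(2 * (w - (a : ℂ)))‖ := by rw [hcrit]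
    rw [norm_mul, norm_neg, norm_mul] at h
    have h2 : ‖(2 : ℂ)‖ = 2 := by simp
    rw [h2] at h
    have h3 := congrArg (· ^ 2) h
    simp only [mul_pow] at h3
    rw [hS_def, h3]; ring
  have hK2 : 0 < ‖K‖ ^ 2 := by positivity
  have hb2 : 0 < b ^ 2 := by positivity
  have hq2 : ‖pairQ a b w‖ ^ 2 = 4 * S / ‖K‖ ^ 2 := by
    rw [eq_div_iff hK2.ne']; exact hM
  rw [hq2] at hP
  -- 4S/‖K‖² = (S + b²)² − 4b²·Im w²  ⇒  solve for b² − Im w²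
  have key : 4 * b ^ 2 * (b ^ 2 - w.im ^ 2) = 4 * S / ‖K‖ ^ 2 + (b ^ 2 - S) * (3 * b ^ 2 + S) := by
    nlinarith [hP]
  field_simp
  nlinarith [key, hK2, hb2]

/-! ## §G.5 the TOUCHER item as a COROLLARY of a dimensionless child law (v4 addition; director (CA535)(2) «preferred exit: prove it»,
instr-1 ADDENDUM 2 «the DIMENSIONLESS DROP LAW R_j := ΔlowH²·κ_j²; R < 1 exactly on the non-nested levels, min 0.996; R1t is carried by the MODULUS
slack») — `ToucherLaw` (F1's summand on the touched class) is NOT provable from `EngineHyps5` (no field-legality conjunct; the walk's laws bind nested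
children only), but it IS the corollary of ONE law whose conclusion is not F1's summand: (R1t′) `TouchChildLaw θ c′` = at a touched charged far level the
lowest pair has a MOVING upper child that is a level-(j+1) BAND STATE, with far field at most `(1+θ)·η/s` (law #2's twin on the touched class; census
κ_w·s/η ≤ 0.973, lens-2 stress ≤ 0.988 at charged rows) and DIMENSIONLESS DROP `c′ ≤ (Im v² − Im w²)·‖K̃(w)‖²` (the toucher version of the PROVED sharp
step's `1/κ² ≤ b² − Im w²`; census min 0.996, CE1 0.99598; `c′ = 81/100` asks 19 % less than the tilt model).  Then F1's summand follows by
`lowH j = Im v`, `lowH (j+1) ≤ Im w` and `c′/(1+θ)² ≥ 4/5` (`(81/100)/(1 + 1/200)² = 0.80196`). -/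

/-- (LAW R1t′ — TOUCHED-CHILD LAW; typed, OPEN; dimensionless) at a charged far level whose lowest isolated pair `v` is disc-touched by a strictly taller
zero of `f⁽ʲ⁾`, `v` has a MOVING upper child `w` (`f⁽ʲ⁺¹⁾ w = 0`, `f⁽ʲ⁾ w ≠ 0`) that is a level-(j+1) band state, whose pair-removed field is capped by
`(1+θ)·η/s` and whose dimensionless drop is at least `c′`: `c′ ≤ (Im v² − Im w²)·‖farFieldAt f j v w‖²`.  Columns T-TOUCH-CAP (kill `> 1+θ`) and
T-TOUCH-R (kill `< c′`). -/
def TouchChildLaw (θ c' : ℝ) : Prop :=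
  ∀ (η : ℝ) (f : ℂ → ℂ) (x₀ s hmax R Hs : ℝ) (B : ℕ), EngineHyps5 2 η f x₀ s hmax R Hs B →
    ∀ (j : ℕ) (v : ℂ), Charged (PTrkSQ PBot) StTrkDQ ReadyR2 η f x₀ s hmax R Hs B j →
      IsLowest StTrkDQ η f x₀ s hmax R Hs B j v →
      (∀ z : ℂ, iteratedDeriv j f z = 0 → |z.re - v.re| < R / 2 → z = v ∨ z = conj v) →
      (∃ z : ℂ, iteratedDeriv j f z = 0 ∧ v.im < z.im ∧ |v.re - z.re| ≤ v.im + z.im) →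
      ∃ w : ℂ, iteratedDeriv (j + 1) f w = 0 ∧ iteratedDeriv j f w ≠ 0 ∧ StTrkDQ η f x₀ s hmax R Hs B (j + 1) w ∧
        ‖farFieldAt f j v w‖ ≤ (1 + θ) * (η / s) ∧ c' ≤ (v.im ^ 2 - w.im ^ 2) * ‖farFieldAt f j v w‖ ^ 2

set_option maxHeartbeats 400000 in
/-- ★★ (K) **THE TOUCHER ITEM IS A COROLLARY**: `TouchChildLaw θ c′ → ToucherLaw` whenever `0 ≤ θ`, `0 < c′` and `4/5·(1+θ)² ≤ c′`
(pure bookkeeping: `lowH j = Im v`, `0 ≤ lowH (j+1) ≤ Im w`, and the two priced clauses; the `η = 0` frame is absurd because the cap forces `K̃(w) = 0`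
against `0 < c′`). -/
theorem toucherLaw_of_touchChildLaw {θ c' : ℝ} (hθ : 0 ≤ θ) (hc' : 0 < c') (hθc : 4 / 5 * (1 + θ) ^ 2 ≤ c')
    (hT : TouchChildLaw θ c') : ToucherLaw := by
  intro η f x₀ s hmax R Hs B hE j v hch hlow hiso htouch
  obtain ⟨-, -, -, hs, -, -, -, -, -, -, -, -, -, hη0, -, -⟩ := id hE
  obtain ⟨w, hw0, hGw, hwS, hcap, hR⟩ := hT η f x₀ s hmax R Hs B hE j v hch hlow hiso htouch
  have hwim : 0 < w.im := hwS.2.2.1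
  have hLj : lowH StTrkDQ η f x₀ s hmax R Hs B j = v.im := lowH_eq_of_isLowest hlow
  have hL1 : lowH StTrkDQ η f x₀ s hmax R Hs B (j + 1) ≤ w.im := by
    have h := lowH_le hwS
    rwa [abs_of_pos hwim] at h
  have hL0 : 0 ≤ lowH StTrkDQ η f x₀ s hmax R Hs B (j + 1) := lowH_nonneg'
  set κ : ℝ := ‖farFieldAt f j v w‖ with hκ
  have hκ0 : 0 ≤ κ := norm_nonneg _
  -- κ > 0: otherwise the drop clause reads c′ ≤ 0
  have hκpos : 0 < κ := by
    rcases hκ0.lt_or_eq with h | h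
    · exact h
    · exfalso; rw [← h] at hR; nlinarith
  -- the drop in heights, then in lowH
  have hdrop : c' / κ ^ 2 ≤ v.im ^ 2 - w.im ^ 2 := by
    rw [div_le_iff₀ (by positivity)]; linarith
  have hdropL : c' / κ ^ 2 ≤ lowH StTrkDQ η f x₀ s hmax R Hs B j ^ 2 - lowH StTrkDQ η f x₀ s hmax R Hs B (j + 1) ^ 2 := by
    rw [hLj]
    have : lowH StTrkDQ η f x₀ s hmax R Hs B (j + 1) ^ 2 ≤ w.im ^ 2 := pow_le_pow_left₀ hL0 hL1 2
    linarith
  -- the cap: κ² ≤ (1+θ)²(η/s)², so η²·c′/κ² ≥ c′ s²/(1+θ)² ≥ 4/5 s²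
  have hcap2 : κ ^ 2 ≤ (1 + θ) ^ 2 * (η / s) ^ 2 := by
    have h0 : 0 ≤ (1 + θ) * (η / s) := by positivity
    have := mul_self_le_mul_self hκ0 hcap
    nlinarith [this]
  have hη2 : 0 ≤ η ^ 2 := sq_nonneg η
  have key : 4 / 5 * s ^ 2 ≤ η ^ 2 * (c' / κ ^ 2) := by
    rw [mul_div_assoc', le_div_iff₀ (by positivity)]
    -- 4/5 s² κ² ≤ η² c′  ⇐  κ² ≤ (1+θ)² η²/s²  and  4/5 (1+θ)² ≤ c′
    have h1 : 4 / 5 * s ^ 2 * κ ^ 2 ≤ 4 / 5 * s ^ 2 * ((1 + θ) ^ 2 * (η / s) ^ 2) :=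
      mul_le_mul_of_nonneg_left hcap2 (by positivity)
    have h2 : 4 / 5 * s ^ 2 * ((1 + θ) ^ 2 * (η / s) ^ 2) = (4 / 5 * (1 + θ) ^ 2) * η ^ 2 := by
      field_simp
    rw [h2] at h1
    calc 4 / 5 * s ^ 2 * κ ^ 2 ≤ (4 / 5 * (1 + θ) ^ 2) * η ^ 2 := h1
      _ ≤ c' * η ^ 2 := mul_le_mul_of_nonneg_right hθc hη2
      _ = η ^ 2 * c' := by ring
  calc 4 / 5 * s ^ 2 ≤ η ^ 2 * (c' / κ ^ 2) := key
    _ ≤ η ^ 2 * (lowH StTrkDQ η f x₀ s hmax R Hs B j ^ 2 - lowH StTrkDQ η f x₀ s hmax R Hs B (j + 1) ^ 2) :=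
        mul_le_mul_of_nonneg_left hdropL hη2

/-- (K) the record constants: `θ = 1/200` (law #2's), `c′ = 81/100`. -/
theorem toucherLaw_of_touchChildLaw_record (hT : TouchChildLaw (1 / 200) (81 / 100)) : ToucherLaw :=
  toucherLaw_of_touchChildLaw (by norm_num) (by norm_num) (by norm_num) hT

/-- ★★★ (K) GLUE-2A with the toucher item as a corollary: `FarChildExistsLawSep → TouchChildLaw (1/200) (81/100) → HalfAloftLaw → F1OfModulusLawA'`. -/
theorem f1OfModulusLawA_of_childLaws' (hX : FarChildExistsLawSep) (hT : TouchChildLaw (1 / 200) (81 / 100)) (hA : HalfAloftLaw) :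
    F1OfModulusLawA' :=
  f1OfModulusLawA_of_childLaws hX (toucherLaw_of_touchChildLaw_record hT) hA

/-- (LAW R1t′-∃ — the TOUCHED-CHILD LAW with the constants EXISTENTIAL; director (CA537), typing checklist (iv)) some admissible pair `(θ, c′)` —
`0 ≤ θ`, `4/5·(1+θ)² ≤ c′` (hence `0 < c′`) — satisfies `TouchChildLaw θ c′`.  The record instance lives in proofs, not in the statement; balanced
candidates against the measured margins: `(7/100, 23/25)` (cap kill 1.07 vs stress 0.988 / census 0.973; drop kill 0.92 vs R_min 0.996). -/
def TouchChildLawEx : Prop :=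
  ∃ θ c' : ℝ, 0 ≤ θ ∧ 4 / 5 * (1 + θ) ^ 2 ≤ c' ∧ TouchChildLaw θ c'

/-- ★★ (K) the corollary from the existential form: `TouchChildLawEx → ToucherLaw` (`0 < c′` is automatic: `c′ ≥ 4/5·(1+θ)² ≥ 4/5`). -/
theorem toucherLaw_of_touchChildLawEx (hT : TouchChildLawEx) : ToucherLaw := by
  obtain ⟨θ, c', hθ, hθc, hlaw⟩ := hT
  have hc' : 0 < c' := lt_of_lt_of_le (by positivity) hθc
  exact toucherLaw_of_touchChildLaw hθ hc' hθc hlaw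

/-- (K) any concrete admissible instance gives the existential (e.g. the balanced `(7/100, 23/25)` or the record `(1/200, 81/100)`). -/
theorem touchChildLawEx_of_instance {θ c' : ℝ} (hθ : 0 ≤ θ) (hθc : 4 / 5 * (1 + θ) ^ 2 ≤ c') (h : TouchChildLaw θ c') :
    TouchChildLawEx :=
  ⟨θ, c', hθ, hθc, h⟩

/-- ★★★ (K) GLUE-2A, existential toucher form: `FarChildExistsLawSep → TouchChildLawEx → HalfAloftLaw → F1OfModulusLawA'`. -/
theorem f1OfModulusLawA_of_childLawsEx (hX : FarChildExistsLawSep) (hT : TouchChildLawEx) (hA : HalfAloftLaw) : F1OfModulusLawA' :=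
  f1OfModulusLawA_of_childLaws hX (toucherLaw_of_touchChildLawEx hT) hA

end RhW08.BurgersRateG3

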